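import Summits.CriticalPhenomena.SAWScalingLimit.Theorems.SAWDevelopingMapNoFoldBoundNoStarvation
import Summits.CriticalPhenomena.SAWScalingLimit.Theorems.SAWDevelopingMapNoFoldBoundNoStarvationSrc
import Summits.CriticalPhenomena.SAWScalingLimit.Theorems.SAWDevelopingMapNoFoldBoundRawDominance

/-!
# `NoFoldBound`, line Ideator3Sketch — depth-2 stratum: no middle-port starvation, RAW first-arrival masses

Crux `NoFoldBound` (stmt-CriticalPhenomena-8296), route `SAWDevelopingMap`, lead seat c5. Companion of
`noStarvation_of_noFoldBound` / `noStarvationSrc_of_noFoldBound` (files `…NoStarvation(Src)`, dressed masses) in the currency of the reshaped dominance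
stubs of skeleton v11 (file `…RawDominance`): the RAW first-arrival mass of a port `w` of `v` is
`N_w = Σ_{γ : a → {v,w}, v ∉ γ} x_c^{ℓ(γ)}`. At an interior vertex `v` off the source with a neighbour `w₀ ∉ a`
touching the complement (`w₀ ∼ x ∉ Λ`, third neighbour `y`, positive labelling `(w₀, w₁, w₂)`, all three
neighbours in `Λ`) — and likewise when `w₀` is the source vertex (`a = {x, w₀}`) — the uniform no-fold bound `NoFoldBound` forces

  `8 · min(N_outer, N_outer') ≤ 15 · N_mid + 5 · max(N_outer, N_outer')`

(middle port `w₁` if `y → w₀ → v` turns left, `w₂` if it turns right). So in the balanced regime (outer raw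
masses within a factor `8/5`) the middle port carries at least `(8·min − 5·max)/15` of raw first-arrival mass:
any proof of the crux must establish a Harnack-type LOWER bound for the middle port of a depth-2 vertex — the
content of the registered stub `stub_rawDominance` (`min ≤ N_mid`, sufficient with slit loops `≤ 1/5` by
`noFold_collarTwo` + `dom_of_rawDominance`) up to the constant.

Proof: `noStarvation_of_noFoldBound` gives `2·min(s) ≤ 3·s_mid + max(s)` for the dressed masses; the slit-loop
bound `c < sin(π/8)` (`sourceLoopBound_of_noFoldBound`, through `stub_slitSC`) gives
`(α_T+β_T)/2 · N ≤ s ≤ α_T · N` portwise (`α_T − √3 x_c sin(π/8) = (α_T+β_T)/2`), and `β_T ≥ 0.6137 α_T`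
(`betaT_ge_alphaT_mul`) turns `(α_T+β_T)·min N ≤ α_T (3 N_mid + max N)` into the stated integer form
(`1.6 ≤ 1.6137`). [folklore assembly]
-/

noncomputable section

open scoped BigOperators
open Literature.Probability.LatticeModels Literature.Probability.RandomPlanarGeometry.SAW

namespace Summit.CriticalPhenomena.SAWScalingLimit.Theorems.SAWDevelopingMapNoFoldBound

/-! ## Raw ≤ dressed, lower comparison under a slit-loop bound -/

/-- **`(α_T+β_T)/2` · raw ≤ dressed.** If every slit loop sum at the port `w` (loops between `{v,p}` and
`{v,q}`) is at most `c < sin(π/8)`, then the dressed sum-mass of `w` is at least `(α_T + β_T)/2` times its raw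
first-arrival mass, because each dressing factor is `α_T − √3 x_c Z ≥ α_T − √3 x_c sin(π/8) = (α_T + β_T)/2`.
[folklore] -/
theorem rawMass_mul_le_dressedMass (Λ : Finset HexVertex) (a : Sym2 HexVertex) (v w p q : HexVertex)
    {c : ℝ} (hc : c < Real.sin (Real.pi / 8))
    (hZ : ∀ γ : HexMidEdgeSAW Λ a s(v, w), v ∉ γ.verts →
      (∑ δ : HexMidEdgeSAW ((Λ \ γ.verts.toFinset).erase v) s(v, p) s(v, q),
        hexCriticalFugacity ^ δ.length) ≤ c) :
    ((1 + 2 * hexCriticalFugacity * Real.cos (5 * Real.pi / 24)) +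
        (1 + 2 * hexCriticalFugacity * Real.cos (11 * Real.pi / 24))) / 2 *
        ∑ γ : HexMidEdgeSAW Λ a s(v, w), (if v ∉ γ.verts then hexCriticalFugacity ^ γ.length else 0) ≤
      ∑ γ : HexMidEdgeSAW Λ a s(v, w), if v ∉ γ.verts then hexCriticalFugacity ^ γ.length *
        (1 + 2 * hexCriticalFugacity * Real.cos (5 * Real.pi / 24) -
          Real.sqrt 3 * hexCriticalFugacity *
            ∑ δ : HexMidEdgeSAW ((Λ \ γ.verts.toFinset).erase v) s(v, p) s(v, q),
              hexCriticalFugacity ^ δ.length) else 0 := by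
  have hαβ := alphaT_sub_betaT
  have hx : 0 ≤ hexCriticalFugacity := nfb_xc_pos.le
  have hsx : 0 ≤ Real.sqrt 3 * hexCriticalFugacity := mul_nonneg (Real.sqrt_nonneg _) hx
  rw [Finset.mul_sum]
  refine Finset.sum_le_sum fun γ _ => ?_
  split_ifs with hγ
  · rw [mul_zero]
  · have hpow : 0 ≤ hexCriticalFugacity ^ γ.length := pow_nonneg hx _
    have hZs : Real.sqrt 3 * hexCriticalFugacity *
        ∑ δ : HexMidEdgeSAW ((Λ \ γ.verts.toFinset).erase v) s(v, p) s(v, q),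
          hexCriticalFugacity ^ δ.length ≤
        Real.sqrt 3 * hexCriticalFugacity * Real.sin (Real.pi / 8) :=
      mul_le_mul_of_nonneg_left ((hZ γ hγ).trans hc.le) hsx
    rw [mul_comm]
    refine mul_le_mul_of_nonneg_left ?_ hpow
    linarith

/-! ## The arithmetic of the raw form -/

/-- The passage from the dressed inequality `2·min(s_A, s_B) ≤ 3·s_M + max(s_A, s_B)` to the raw one
`8·min(N_A, N_B) ≤ 15·N_M + 5·max(N_A, N_B)` under the portwise comparisons
`(α+β)/2 · N ≤ s ≤ α · N` (outer ports `A, B`), `s_M ≤ α N_M`, with `β ≥ 0.6137 α`, `α > 0`. [folklore] -/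
theorem raw_of_dressed_noStarvation {α β sA sB sM NA NB NM : ℝ} (hα : 0 < α)
    (hβ : 6137 / 10000 * α ≤ β) (hNA : 0 ≤ NA) (hNB : 0 ≤ NB)
    (lA : (α + β) / 2 * NA ≤ sA) (lB : (α + β) / 2 * NB ≤ sB)
    (uA : sA ≤ α * NA) (uB : sB ≤ α * NB) (uM : sM ≤ α * NM)
    (h : 2 * min sA sB ≤ 3 * sM + max sA sB) :
    8 * min NA NB ≤ 15 * NM + 5 * max NA NB := by
  have hαβ : 0 ≤ (α + β) / 2 := by nlinarith
  rcases le_total NA NB with hAB | hAB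
  · rw [min_eq_left hAB, max_eq_right hAB]
    have m : (α + β) / 2 * NA ≤ min sA sB :=
      le_min lA ((mul_le_mul_of_nonneg_left hAB hαβ).trans lB)
    have M : max sA sB ≤ α * NB := max_le (uA.trans (mul_le_mul_of_nonneg_left hAB hα.le)) uB
    have key : α * (8 * NA) ≤ α * (15 * NM + 5 * NB) := by nlinarith [mul_nonneg hα.le hNA]
    exact le_of_mul_le_mul_left key hα
  · rw [min_eq_right hAB, max_eq_left hAB]
    have m : (α + β) / 2 * NB ≤ min sA sB :=
      le_min ((mul_le_mul_of_nonneg_left hAB hαβ).trans lA) lB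
    have M : max sA sB ≤ α * NA := max_le uA (uB.trans (mul_le_mul_of_nonneg_left hAB hα.le))
    have key : α * (8 * NB) ≤ α * (15 * NM + 5 * NA) := by nlinarith [mul_nonneg hα.le hNB]
    exact le_of_mul_le_mul_left key hα

/-! ## The raw no-starvation inequality -/

/-- **No middle-port starvation at depth 2 under `NoFoldBound`, raw first-arrival masses.** Let `Λ` be
simply connected with source `a ∈ ∂Ω`, `v ∈ Λ` off `a` with pairwise distinct neighbours `w₀, w₁, w₂ ∈ Λ` in
the positive order (turn `w₀ → v → w₁ = +π/3`), `w₀` off `a` TOUCHING the complement: `w₀ ∼ x ∉ Λ` (`x ≠ v`)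
with third neighbour `y`; let `N_w = Σ_{γ : a → {v,w}, v ∉ γ} x_c^{ℓ(γ)}` be the raw first-arrival masses of
the ports. If `NoFoldBound` holds, then `8·min(N(w₀), N(w₂)) ≤ 15·N(w₁) + 5·max(N(w₀), N(w₂))` if `y → w₀ → v`
turns left (middle port `w₁`) and `8·min(N(w₀), N(w₁)) ≤ 15·N(w₂) + 5·max(N(w₀), N(w₁))` if it turns right
(middle port `w₂`). The conjectured sufficient input of the line (`stub_rawDominance`) is `min ≤ N_mid`.
[folklore assembly] -/
theorem rawNoStarvation_of_noFoldBound
    (hK : Summit.CriticalPhenomena.SAWScalingLimit.Theses.SAWDevelopingMap.NoFoldBound) :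
    ∀ (Λ : Finset HexVertex), hexDomainSimplyConnected Λ → ∀ a ∈ hexDomainBoundary Λ,
      ∀ v ∈ Λ, v ∉ a → ∀ w₀ w₁ w₂ x y : HexVertex, hexGraph.Adj v w₀ → hexGraph.Adj v w₁ →
      hexGraph.Adj v w₂ → w₀ ≠ w₁ → w₁ ≠ w₂ → w₀ ≠ w₂ → w₀ ∈ Λ → w₁ ∈ Λ → w₂ ∈ Λ → w₀ ∉ a →
      winding [hexMidpoint s(w₀, v), hexCenter v, hexMidpoint s(v, w₁)] = Real.pi / 3 →
      hexGraph.Adj w₀ x → hexGraph.Adj w₀ y → v ≠ x → x ≠ y → v ≠ y → x ∉ Λ →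
      let N : HexVertex → ℝ := fun w =>
        ∑ γ : HexMidEdgeSAW Λ a s(v, w), if v ∉ γ.verts then hexCriticalFugacity ^ γ.length else 0
      (winding [hexMidpoint s(y, w₀), hexCenter w₀, hexMidpoint s(w₀, v)] = Real.pi / 3 →
          8 * min (N w₀) (N w₂) ≤ 15 * N w₁ + 5 * max (N w₀) (N w₂)) ∧
        (winding [hexMidpoint s(y, w₀), hexCenter w₀, hexMidpoint s(w₀, v)] = -(Real.pi / 3) →
          8 * min (N w₀) (N w₁) ≤ 15 * N w₂ + 5 * max (N w₀) (N w₁)) := by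
  intro Λ hΛ a ha v hv hva w₀ w₁ w₂ xo y h₀ h₁ h₂ h₀₁ h₁₂ h₀₂ hw₀ hw₁ hw₂ hw₀a hchir hwx hwy hvx hxy hvy
    hx
  dsimp only
  have hNS := noStarvation_of_noFoldBound hK Λ hΛ a ha v hv hva w₀ w₁ w₂ xo y h₀ h₁ h₂ h₀₁ h₁₂ h₀₂ hw₀
    hw₁ hw₂ hw₀a hchir hwx hwy hvx hxy hvy hx
  dsimp only at hNS
  obtain ⟨c, hc, HL⟩ := sourceLoopBound_of_noFoldBound hK
  -- slit-loop bounds (`≤ c`; slit domains are simply connected)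
  have loop_bd : ∀ (e p q : HexVertex), hexGraph.Adj v e → hexGraph.Adj v p → hexGraph.Adj v q →
      e ≠ p → e ≠ q → p ≠ q → ∀ γ : HexMidEdgeSAW Λ a s(v, e), v ∉ γ.verts →
      (∑ δ : HexMidEdgeSAW ((Λ \ γ.verts.toFinset).erase v) s(v, p) s(v, q),
        hexCriticalFugacity ^ δ.length) ≤ c := by
    intro e p q he hp hq hep heq hpq γ hγ
    have heγ : e ∈ γ.verts := mem_verts_of_firstArrival hva γ hγ
    have he' : e ∉ Λ \ γ.verts.toFinset := fun h =>
      (Finset.mem_sdiff.1 h).2 (List.mem_toFinset.2 heγ)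
    have hv' : v ∈ Λ \ γ.verts.toFinset :=
      Finset.mem_sdiff.2 ⟨hv, fun h => hγ (List.mem_toFinset.1 h)⟩
    exact HL _ (stub_slitSC Λ hΛ a ha _ γ) e v p q he' hv' he hp hq hep heq hpq
  -- portwise comparisons of dressed and raw masses
  have l0 := rawMass_mul_le_dressedMass Λ a v w₀ w₁ w₂ hc (loop_bd w₀ w₁ w₂ h₀ h₁ h₂ h₀₁ h₀₂ h₁₂)
  have l1 := rawMass_mul_le_dressedMass Λ a v w₁ w₂ w₀ hc
    (loop_bd w₁ w₂ w₀ h₁ h₂ h₀ h₁₂ h₀₁.symm h₀₂.symm)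
  have l2 := rawMass_mul_le_dressedMass Λ a v w₂ w₀ w₁ hc
    (loop_bd w₂ w₀ w₁ h₂ h₀ h₁ h₀₂.symm h₁₂.symm h₀₁)
  have u0 := dressedMass_le_alphaT_mul_rawMass Λ a v w₀ w₁ w₂
  have u1 := dressedMass_le_alphaT_mul_rawMass Λ a v w₁ w₂ w₀
  have u2 := dressedMass_le_alphaT_mul_rawMass Λ a v w₂ w₀ w₁
  have n0 : 0 ≤ ∑ γ : HexMidEdgeSAW Λ a s(v, w₀),
      (if v ∉ γ.verts then hexCriticalFugacity ^ γ.length else 0) :=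
    Finset.sum_nonneg fun γ _ => by split_ifs <;> [exact le_rfl; exact pow_nonneg nfb_xc_pos.le _]
  have n1 : 0 ≤ ∑ γ : HexMidEdgeSAW Λ a s(v, w₁),
      (if v ∉ γ.verts then hexCriticalFugacity ^ γ.length else 0) :=
    Finset.sum_nonneg fun γ _ => by split_ifs <;> [exact le_rfl; exact pow_nonneg nfb_xc_pos.le _]
  have n2 : 0 ≤ ∑ γ : HexMidEdgeSAW Λ a s(v, w₂),
      (if v ∉ γ.verts then hexCriticalFugacity ^ γ.length else 0) :=
    Finset.sum_nonneg fun γ _ => by split_ifs <;> [exact le_rfl; exact pow_nonneg nfb_xc_pos.le _]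
  have hβ := betaT_ge_alphaT_mul
  have hα : 0 < 1 + 2 * hexCriticalFugacity * Real.cos (5 * Real.pi / 24) := nfb_alphaT_pos
  constructor
  · intro hleft
    exact raw_of_dressed_noStarvation hα hβ n0 n2 l0 l2 u0 u2 u1 (hNS.1 hleft)
  · intro hright
    exact raw_of_dressed_noStarvation hα hβ n0 n1 l0 l1 u0 u1 u2 (hNS.2 hright)

/-- **No middle-port starvation, raw masses, source-adjacent position.** The statement of
`rawNoStarvation_of_noFoldBound` with the touching neighbour `w₀` equal to the SOURCE VERTEX (`a = {x, w₀}`,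
`x ∉ Λ`, third neighbour `y`): under `NoFoldBound`, `8·min(N_outer) ≤ 15·N_mid + 5·max(N_outer)` at every
interior vertex adjacent to the source vertex (from `noStarvationSrc_of_noFoldBound`). The conjectured sufficient
input of the line there is `stub_rawDominanceSrc` (`min ≤ N_mid`). [folklore assembly] -/
theorem rawNoStarvationSrc_of_noFoldBound
    (hK : Summit.CriticalPhenomena.SAWScalingLimit.Theses.SAWDevelopingMap.NoFoldBound) :
    ∀ (Λ : Finset HexVertex), hexDomainSimplyConnected Λ → ∀ a ∈ hexDomainBoundary Λ,
      ∀ v ∈ Λ, v ∉ a → ∀ w₀ w₁ w₂ x y : HexVertex, hexGraph.Adj v w₀ → hexGraph.Adj v w₁ →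
      hexGraph.Adj v w₂ → w₀ ≠ w₁ → w₁ ≠ w₂ → w₀ ≠ w₂ → w₀ ∈ Λ → w₁ ∈ Λ → w₂ ∈ Λ → a = s(x, w₀) →
      winding [hexMidpoint s(w₀, v), hexCenter v, hexMidpoint s(v, w₁)] = Real.pi / 3 →
      hexGraph.Adj w₀ x → hexGraph.Adj w₀ y → v ≠ x → x ≠ y → v ≠ y → x ∉ Λ →
      let N : HexVertex → ℝ := fun w =>
        ∑ γ : HexMidEdgeSAW Λ a s(v, w), if v ∉ γ.verts then hexCriticalFugacity ^ γ.length else 0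
      (winding [hexMidpoint s(y, w₀), hexCenter w₀, hexMidpoint s(w₀, v)] = Real.pi / 3 →
          8 * min (N w₀) (N w₂) ≤ 15 * N w₁ + 5 * max (N w₀) (N w₂)) ∧
        (winding [hexMidpoint s(y, w₀), hexCenter w₀, hexMidpoint s(w₀, v)] = -(Real.pi / 3) →
          8 * min (N w₀) (N w₁) ≤ 15 * N w₂ + 5 * max (N w₀) (N w₁)) := by
  intro Λ hΛ a ha v hv hva w₀ w₁ w₂ xo y h₀ h₁ h₂ h₀₁ h₁₂ h₀₂ hw₀ hw₁ hw₂ hax hchir hwx hwy hvx hxy hvy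
    hx
  dsimp only
  have hNS := noStarvationSrc_of_noFoldBound hK Λ hΛ a ha v hv hva w₀ w₁ w₂ xo y h₀ h₁ h₂ h₀₁ h₁₂ h₀₂
    hw₀ hw₁ hw₂ hax hchir hwx hwy hvx hxy hvy hx
  dsimp only at hNS
  obtain ⟨c, hc, HL⟩ := sourceLoopBound_of_noFoldBound hK
  -- slit-loop bounds (`≤ c`; slit domains are simply connected)
  have loop_bd : ∀ (e p q : HexVertex), hexGraph.Adj v e → hexGraph.Adj v p → hexGraph.Adj v q →
      e ≠ p → e ≠ q → p ≠ q → ∀ γ : HexMidEdgeSAW Λ a s(v, e), v ∉ γ.verts →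
      (∑ δ : HexMidEdgeSAW ((Λ \ γ.verts.toFinset).erase v) s(v, p) s(v, q),
        hexCriticalFugacity ^ δ.length) ≤ c := by
    intro e p q he hp hq hep heq hpq γ hγ
    have heγ : e ∈ γ.verts := mem_verts_of_firstArrival hva γ hγ
    have he' : e ∉ Λ \ γ.verts.toFinset := fun h =>
      (Finset.mem_sdiff.1 h).2 (List.mem_toFinset.2 heγ)
    have hv' : v ∈ Λ \ γ.verts.toFinset :=
      Finset.mem_sdiff.2 ⟨hv, fun h => hγ (List.mem_toFinset.1 h)⟩
    exact HL _ (stub_slitSC Λ hΛ a ha _ γ) e v p q he' hv' he hp hq hep heq hpq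
  -- portwise comparisons of dressed and raw masses
  have l0 := rawMass_mul_le_dressedMass Λ a v w₀ w₁ w₂ hc (loop_bd w₀ w₁ w₂ h₀ h₁ h₂ h₀₁ h₀₂ h₁₂)
  have l1 := rawMass_mul_le_dressedMass Λ a v w₁ w₂ w₀ hc
    (loop_bd w₁ w₂ w₀ h₁ h₂ h₀ h₁₂ h₀₁.symm h₀₂.symm)
  have l2 := rawMass_mul_le_dressedMass Λ a v w₂ w₀ w₁ hc
    (loop_bd w₂ w₀ w₁ h₂ h₀ h₁ h₀₂.symm h₁₂.symm h₀₁)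
  have u0 := dressedMass_le_alphaT_mul_rawMass Λ a v w₀ w₁ w₂
  have u1 := dressedMass_le_alphaT_mul_rawMass Λ a v w₁ w₂ w₀
  have u2 := dressedMass_le_alphaT_mul_rawMass Λ a v w₂ w₀ w₁
  have n0 : 0 ≤ ∑ γ : HexMidEdgeSAW Λ a s(v, w₀),
      (if v ∉ γ.verts then hexCriticalFugacity ^ γ.length else 0) :=
    Finset.sum_nonneg fun γ _ => by split_ifs <;> [exact le_rfl; exact pow_nonneg nfb_xc_pos.le _]
  have n1 : 0 ≤ ∑ γ : HexMidEdgeSAW Λ a s(v, w₁),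
      (if v ∉ γ.verts then hexCriticalFugacity ^ γ.length else 0) :=
    Finset.sum_nonneg fun γ _ => by split_ifs <;> [exact le_rfl; exact pow_nonneg nfb_xc_pos.le _]
  have n2 : 0 ≤ ∑ γ : HexMidEdgeSAW Λ a s(v, w₂),
      (if v ∉ γ.verts then hexCriticalFugacity ^ γ.length else 0) :=
    Finset.sum_nonneg fun γ _ => by split_ifs <;> [exact le_rfl; exact pow_nonneg nfb_xc_pos.le _]
  have hβ := betaT_ge_alphaT_mul
  have hα : 0 < 1 + 2 * hexCriticalFugacity * Real.cos (5 * Real.pi / 24) := nfb_alphaT_pos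
  constructor
  · intro hleft
    exact raw_of_dressed_noStarvation hα hβ n0 n2 l0 l2 u0 u2 u1 (hNS.1 hleft)
  · intro hright
    exact raw_of_dressed_noStarvation hα hβ n0 n1 l0 l1 u0 u1 u2 (hNS.2 hright)

end Summit.CriticalPhenomena.SAWScalingLimit.Theorems.SAWDevelopingMapNoFoldBound

end
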